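import Summits.HodgeConjecture.HodgeConjecture.Theorems.CurveNetMordellWeilVerticalSupportMiddleReduction
import Literature.AlgebraicGeometry.HodgeTheory.SupportedClassesOfChowZeroSupported
import Literature.AlgebraicGeometry.HodgeTheory.CorrespondenceActionHodgeClassesOfGysinResolved
import Literature.AlgebraicGeometry.HodgeTheory.TopHodgeClassesSpannedByPullbacksFact
import Literature.Barriers.HodgeConjecture.DecompositionOfTheDiagonalDegreeFourOfGysinHodgeCompatible

/-!
# Route CurveNetMordellWeil, crux `VerticalSupportMiddle` (stmt-HodgeConjecture-2782): the CH₀-degenerate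
# regime of the middle step — Voisin II, Prop. 10.26 in every even dimension (helpers, `--supports`)

Line `regime-split-middle-step`, stub 2 (`stub_chowDegenerateRegime_of_decomposition` of the strategist
skeleton `Cruxes/VerticalSupportMiddle/Lines/regime_split_middle_step.lean`): **the middle-dimensional
step of the Hodge conjecture for CH₀-DEGENERATE `2q`-folds**, `MiddleStepFor ChowZeroDegenerate`
(definitions in `CurveNetMordellWeilDefs`): for `q ≥ 2`, `X` smooth projective of dimension `2q` whose
`0`-cycles are all rationally equivalent on `X` to `0`-cycles supported on a proper closed `W ⊊ X`, the
Hodge conjecture in all dimensions `< 2q` implies that every rational `(q,q)`-class on `X` is algebraic.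

PROVED here **granted a Gysin / cycle-class formalism whose Gysin morphisms are Hodge compatible**
(`(G : GysinFormalism) (hG : G.IsGysinHodgeCompatible)`, the tree's idiom: a hypothesis STRUCTURE taken
as a parameter, for which `exists_gysinFormalism_isGysinHodgeCompatible_complexOrientation` supplies an
instance granted the two named facts `Fulton1998_degreeFormula_complexOrientation` — Fulton, Lemma
19.1.2 for the complex orientations — and `Voisin2003_cycleClass_div_eq_zero_complexOrientation` —
Voisin II, Lemma 9.18 in generator form; the second follows from the first and
`topHodgeClasses_spanned_by_pullbacks`): `middleStepChowDegenerate_of_gysin` (registered sub-goal), with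
the corollaries `middleStepChowDegenerate_of_complexOrientationFacts`,
`middleStepChowDegenerate_of_degreeFormula_of_spanning` naming that trust base. The antecedent of the
strategist's stub, the Bloch–Srinivas decomposition of the diagonal, is a THEOREM of the tree
(`Literature.Barriers.HodgeConjecture.BlochSrinivas1983_decompositionOfTheDiagonal_holds`) and is used,
not assumed.

## The proof (Voisin II, proof of Prop. 10.26, p. 306, in dimension `2q` with the induction hypothesis)

`m[Δ_X] ∼_rat Z' + Z''` with `m > 0`, `Z'` supported in `T × X` (`T ⊊ X` closed), `Z''` supported in
`X × W` (Cor. 10.21); Lemma 9.18 and `[Δ_X]^* = Id` (`GysinFormalism.corrAct_congr`,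
`….corrAct_primeCycle_diagonal`) give `m c = [Z']^*c + [Z'']^*c` on `H^{2q}(X(ℂ); ℂ)`. Prime cycle by
prime cycle (`GysinFormalism.corrAct_mem_of_primeCycle`):

* `V = closure {z}`, `pr₁ z ∈ T` (`corrAct_mem_algebraicClasses_of_fst_of_hodgeBelowDim`): `[V]^*c`
  dies off `T` ((10.8), `GysinFormalism.corrAct_mem_supportedClasses_of_fst_mem`), so has coniveau `≥ 1`;
  through a resolution `τ : Ṽ → X ⊗ X` of `V` (projective Hironaka, a theorem of the tree) it is
  `(τ ≫ pr₁)_*((τ ≫ pr₂)^* c)` (`GysinFormalism.corrActGen_primeCycle_eq`), hence RATIONAL and of TYPE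
  `(q,q)` (`IsGysinHodgeCompatible`); so it is algebraic by Deligne descent + the induction hypothesis
  (`supportedHodgeClasses_algebraic_of_hodgeBelowDim`). This replaces Voisin's "Lefschetz `(1,1)` on
  `T̃`" by descent, uniformly in `q`.
* `V = closure {z}`, `pr₂ z = x' ∈ W` (`corrAct_primeCycle_mem_algebraicClasses_of_snd_of_hodgeBelowDim`):
  with `j : X₁ → closure {x'} ⊆ X` a projective resolution (`dim X₁ = d' < 2q` since `W ≠ X`) and `[V₁]`
  the lift of `[V]` along `X ◁ j` (`Motives.primeCycle_lift_of_isBirational_holds`),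
  `[V]^*c = [V₁]^*(j^*c)` ((10.9), `GysinFormalism.corrActGen_cyclesOfDimMap_whiskerLeft`); `β = j^*c` is a
  rational `(q,q)`-class on `X₁`, ALGEBRAIC by the induction hypothesis; through a resolution
  `τ₁ : Ṽ₁ → X ⊗ X₁` of `V₁`, `[V₁]^*β = g_*(h^*β)` with `h = τ₁ ≫ pr₂ : Ṽ₁ → X₁` DOMINANT (`pr₂ z₁` is the
  generic point of `X₁`: its image `x'` under the closed map `j` has dimension `d' = dim X₁`,
  `eq_genericPoint_of_le_height_base`) and `g = τ₁ ≫ pr₁`; `β` dies off a closed `S ⊊ X₁`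
  (`exists_isClosed_of_mem_supportedClasses`), so `h^*β` dies off the PROPER closed `h⁻¹(S)`: a rational
  `(q,q)`-class of coniveau `≥ 1` on the `2q`-fold `Ṽ₁`, algebraic by descent + the hypothesis again, and
  `g_*` maps algebraic classes to algebraic classes (`GysinFormalism.gysin_mem_algebraicClasses`). Neither
  Prop. 9.20 (cup products of algebraic classes) nor the Hodge compatibility of `G` is used for `Z''`.

The degree-`4` case (`q = 2` without the induction hypothesis, `dim X' ≤ 3`) is the tree's
`BlochSrinivas1983_hodgeConjectureDegreeFour_of_chowZeroSupported_of_gysinHodgeCompatible`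
(`Barriers/HodgeConjecture/DecompositionOfTheDiagonalDegreeFourOfGysinHodgeCompatible`, whose bookkeeping
lemma `base_eq_of_map_primeCycle_eq` is reused); the present file is its analogue in every even
dimension, the Hodge conjecture in dimension `≤ 3` being replaced by the induction hypothesis and
Lefschetz `(1,1)` on `T̃` by descent.

Hodge-theoretic inputs, all THEOREMS of the tree: `nonempty_hodgeModel_holds`,
`hodgePQ_independent_of_hodgeModel_holds` (pull-backs preserve Hodge types), projective Hironaka
(`Resolution.Hironaka1964_projective_holds`), the two descent facts (`Deligne1974_…_holds`,
`Voisin2025_…_holds`, inside `supportedHodgeClasses_algebraic_of_hodgeBelowDim`).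

## References

* [VoisinHodgeII2003] C. Voisin, Hodge Theory and Complex Algebraic Geometry II, Prop. 10.26 and its
  proof (p. 306), Cor. 10.21, Lemma 9.18, proof of Thm. 10.17 (10.5)–(10.9), Prop. 9.21.
* [VoisinHodgeI2002] C. Voisin, Hodge Theory and Complex Algebraic Geometry I, §7.3.2, §11.1.4.
* [BlochSrinivas1983] S. Bloch, V. Srinivas, Amer. J. Math. 105 (1983), Prop. 1 / Thm. 1.
* [ConteMurre1978] A. Conte, J. P. Murre, Math. Ann. 238 (1978).
* [Kollar2007] J. Kollár, Lectures on Resolution of Singularities, Thm. 3.27.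
* [Fulton1998] W. Fulton, Intersection Theory, §1.4, Lemma 19.1.2.
* [Hartshorne1977] R. Hartshorne, Algebraic Geometry, II Ex. 3.20.
-/

noncomputable section

-- `Summit.HodgeConjecture.HodgeConjecture.Theorems` is the mandated namespace (single-problem summit:
-- Problem = Summit), which `linter.dupNamespace` flags on every declaration; the lakefile turns the
-- linter off tree-wide (weak option), restated here so stand-alone elaboration is warning-free too.
set_option linter.dupNamespace false

namespace Summit.HodgeConjecture.HodgeConjecture.Theorems

open CategoryTheory AlgebraicGeometry MonoidalCategory CartesianMonoidalCategory
open Literature.AlgebraicGeometry Literature.AlgebraicGeometry.Motives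
  Literature.AlgebraicGeometry.HodgeTheory Literature.AlgebraicTopology.SingularHomology
  Literature.Barriers.HodgeConjecture
open RegimeSplit

/-! ### A geometric helper: dominance read off dimensions -/

/-- A point `ξ` of a smooth projective `d`-fold `X₁` whose image under a morphism `j : X₁ ⟶ X` of
smooth projective varieties has dimension `≥ d` is the generic point of `X₁` (closed maps do not
raise dimensions of points, and `dim + codim = d` on `X₁`). [cite: Hartshorne1977, II Ex. 3.20] -/
theorem eq_genericPoint_of_le_height_base {d n : ℕ} {X₁ X : SchemeOver ℂ}
    (hX₁ : IsSmoothProjective d X₁) (hX : IsSmoothProjective n X) (j : X₁ ⟶ X) (ξ : X₁.left)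
    (hξ : (d : ℕ∞) ≤ Order.height (j.left.base ξ)) :
    IsGenericPoint ξ (Set.univ : Set X₁.left) := by
  haveI := irreducibleSpace_of_isSmoothProjective' hX₁
  have hf : IsClosedMap j.left.base :=
    haveI := isProper_left_of_isSmoothProjective hX₁ hX j
    j.left.isClosedMap
  have h1 : Order.height (j.left.base ξ) ≤ Order.height ξ :=
    Motives.height_base_le_of_isClosedMap j.left hf ξ
  obtain ⟨a, c, ha, hc, hac⟩ := exists_height_eq_coheight_eq hX₁ ξ
  have hda : d ≤ a := by
    rw [ha] at h1
    exact_mod_cast hξ.trans h1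
  have hc0 : Order.coheight ξ = 0 := by
    rw [hc]
    exact_mod_cast (show c = 0 by omega)
  rw [Order.coheight_eq_zero] at hc0
  have hle : ξ ≤ genericPoint X₁.left :=
    Scheme.le_iff_specializes.2 ((genericPoint_spec X₁.left).specializes (Set.mem_univ ξ))
  have hge : genericPoint X₁.left ≤ ξ := hc0 hle
  have heq : ξ = genericPoint X₁.left :=
    (Specializes.antisymm (Scheme.le_iff_specializes.mp hge) (Scheme.le_iff_specializes.mp hle)).eq
  rw [heq]
  exact genericPoint_spec X₁.left

/-! ### (10.8): correspondences supported in `T × X` -/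

/-- **`[Z']^*c` is algebraic for `Z'` supported in `T × X`, `T ⊊ X`, given HC below dimension `2q`.**
For a prime cycle `V = closure {z}` with `pr₁ z ∈ T`: `[V]^*c` dies off `T` ((10.8)), so has
coniveau `≥ 1`; computed through a resolution `τ : Ṽ → X ⊗ X` it is `(τ ≫ pr₁)_*((τ ≫ pr₂)^* c)`, hence
rational and of type `(q,q)` (Gysin morphisms are Hodge compatible); so it is algebraic by Deligne
descent and the induction hypothesis (`supportedHodgeClasses_algebraic_of_hodgeBelowDim`).
Additivity over prime cycles. [cite: VoisinHodgeII2003, proof of Prop. 10.26 (p. 306) and proof of Thm. 10.17 (10.8)]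
[cite: VoisinHodgeI2002, §7.3.2] -/
theorem corrAct_mem_algebraicClasses_of_fst_of_hodgeBelowDim (G : GysinFormalism)
    (hG : G.IsGysinHodgeCompatible) {q : ℕ} {X : SchemeOver ℂ} (hX : IsSmoothProjective (2 * q) X)
    (ih : HodgeBelowDim (2 * q)) {Z : ↥(cyclesOfDim (X ⊗ X).left (2 * q))} {T : Set X.left}
    (hT : IsClosed T) (hTne : T ≠ Set.univ)
    (hZ : ∀ z, (Z : AlgebraicCycle (X ⊗ X).left ℤ) z ≠ 0 → (fst X X).left.base z ∈ T)
    (c : complexBetti X (2 * q)) (hc : IsRationalClass c) (hh : IsOfHodgeType (2 * q) X (2 * q) q q c) :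
    G.corrAct hX hX (2 * q) Z c ∈ algebraicClasses X q := by
  have hH := Literature.AlgebraicGeometry.Resolution.Hironaka1964_projective_holds
  have hXX := IsSmoothProjective.tensor_holds hX hX
  refine G.corrAct_mem_of_primeCycle hX hX (2 * q) _ Z c fun z hz0 hz ↦ ?_
  -- the prime cycle `closure {z}` is supported in `T × X`
  have hsuppT : ∀ w, (primeCycle z : AlgebraicCycle (X ⊗ X).left ℤ) w ≠ 0 →
      (fst X X).left.base w ∈ T := by
    intro w hw
    have hwz : w = z := by
      by_contra h
      exact hw (primeCycle_apply_of_ne h)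
    rw [hwz]
    exact hZ z hz0
  -- (i) coniveau `≥ 1`
  have hsupp : G.corrAct hX hX (2 * q) ⟨primeCycle z, hz⟩ c ∈ supportedClasses X (2 * q) 1 :=
    G.corrAct_mem_supportedClasses_of_fst_mem hX (2 * q) hT
      (one_le_coheight_of_isClosed_of_ne_univ hX hT hTne) hsuppT c
  -- (ii) rational and of type `(q,q)`, through a resolution of `closure {z}`
  have hzn : Order.height z = ((2 * q : ℕ) : ℕ∞) := hz z (by
    rw [primeCycle_apply_self]; exact one_ne_zero)
  obtain ⟨V, τ, η, hV, hηg, hηn, hτ⟩ := exists_resolution_primeCycle hH hXX z hzn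
  haveI : QuasiCompact τ.left := by
    haveI := isProper_left_of_isSmoothProjective hV hXX τ
    infer_instance
  have hη : primeCycle η ∈ cyclesOfDim V.left (2 * q) := primeCycle_mem_cyclesOfDim hηn
  have hτ' : cyclesOfDimMap (2 * q) τ.left ⟨primeCycle η, hη⟩ = ⟨primeCycle z, hz⟩ := Subtype.ext hτ
  obtain ⟨B⟩ := (nonempty_hodgeModel_holds (n := 2 * q) (X := V)).nonempty hV
  have hrat : IsRationalClass (G.corrAct hX hX (2 * q) ⟨primeCycle z, hz⟩ c) := by
    rw [G.corrAct_eq_corrActGen]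
    exact hG.isRationalClass_corrActGen_primeCycle hX hX _ _ z hz hV τ η hηg hη hτ' hc
  have htyp : IsOfHodgeType (2 * q) X (2 * q) q q (G.corrAct hX hX (2 * q) ⟨primeCycle z, hz⟩ c) := by
    rw [G.corrAct_eq_corrActGen]
    exact hG.isOfHodgeType_corrActGen_primeCycle hX hX _ _ z hz hV τ η hηg hη hτ' B le_rfl
      (by omega) (by omega) hh
  exact supportedHodgeClasses_algebraic_of_hodgeBelowDim ih hX _ hrat htyp hsupp

/-! ### (10.9): correspondences supported in `X × W` -/

/-- **`[V]^*c` is algebraic for a prime cycle `V = closure {z} ⊆ X ⊗ X` over a point `x' = pr₂ z`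
of positive codimension, given HC below dimension `2q`** (`q ≥ 1`). With `j : X₁ → closure {x'} ⊆ X`
a projective resolution (`dim X₁ = d' < 2q`) and `[V₁]` the lift of `[V]` along `X ◁ j`:
`[V]^*c = [V₁]^*(j^*c)` ((10.9)); `β = j^*c` is a rational `(q,q)`-class on `X₁`, ALGEBRAIC by the
induction hypothesis; through a resolution `τ : Ṽ₁ → X ⊗ X₁` of `V₁`, `[V₁]^*β = g_*(h^*β)` with
`h = τ ≫ pr₂ : Ṽ₁ → X₁` DOMINANT (`pr₂ z₁` is the generic point of `X₁`) and `g = τ ≫ pr₁`; so `h^*β`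
is a rational `(q,q)`-class on the `2q`-fold `Ṽ₁` supported on the proper closed `h⁻¹(S)` (`β` dies
off a closed `S ⊊ X₁`), hence algebraic by descent + the hypothesis, and `g_*` preserves algebraic
classes. No cup product of algebraic classes (Prop. 9.20) is used.
[cite: VoisinHodgeII2003, proof of Prop. 10.26 (p. 306) and proof of Thm. 10.17 (10.9)] [cite: Kollar2007, Thm. 3.27] -/
theorem corrAct_primeCycle_mem_algebraicClasses_of_snd_of_hodgeBelowDim (G : GysinFormalism)
    {q : ℕ} {X : SchemeOver ℂ} (hX : IsSmoothProjective (2 * q) X)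
    (hq : 1 ≤ q) (ih : HodgeBelowDim (2 * q)) (z : ↥(X ⊗ X).left)
    (hz : primeCycle z ∈ cyclesOfDim (X ⊗ X).left (2 * q))
    (hzn : Order.height z = ((2 * q : ℕ) : ℕ∞))
    (h1 : (1 : ℕ∞) ≤ Order.coheight ((snd X X).left.base z))
    (c : complexBetti X (2 * q)) (hc : IsRationalClass c) (hh : IsOfHodgeType (2 * q) X (2 * q) q q c) :
    G.corrAct hX hX (2 * q) ⟨primeCycle z, hz⟩ c ∈ algebraicClasses X q := by
  classical
  have hH := Literature.AlgebraicGeometry.Resolution.Hironaka1964_projective_holds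
  have hI : hodgePQ_independent_of_hodgeModel := hodgePQ_independent_of_hodgeModel_holds
  set x' := (snd X X).left.base z with hx'
  set X₀ := ClosedSubvariety.ofPoint X.left x' with hX₀
  obtain ⟨d', X₁, π, hX₁, hπ, hdim⟩ := exists_resolution_ofPoint hH hX x'
  -- `d' = dim closure {x'} < 2q`
  have hd' : d' < 2 * q := by
    obtain ⟨a, b, ha, hb, hab⟩ := exists_height_eq_coheight_eq hX x'
    rw [hdim] at ha
    rw [hb] at h1
    have ha' : d' = a := by exact_mod_cast ha
    have hb' : 1 ≤ b := by exact_mod_cast h1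
    omega
  have hXX₁ := IsSmoothProjective.tensor_holds hX hX₁
  haveI := noetherianSpace_of_isSmoothProjective hXX₁
  set j : X₁ ⟶ X := π ≫ X₀.ιOver with hj
  -- lift `[closure z]` along `X ◁ j`
  obtain ⟨z₁, hz₁, hmap⟩ := primeCycle_lift_of_isBirational_holds hX hX hX₁ X₀ j π.left rfl hπ z
    (by rw [ClosedSubvariety.genericPoint_ofPoint])
  have hz₁n' : Order.height z₁ = ((2 * q : ℕ) : ℕ∞) := by rw [hz₁, hzn]
  have hz₁n : primeCycle z₁ ∈ cyclesOfDim (X ⊗ X₁).left (2 * q) := primeCycle_mem_cyclesOfDim hz₁n'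
  have hpush : cyclesOfDimMap (2 * q) (X ◁ j).left ⟨primeCycle z₁, hz₁n⟩ = ⟨primeCycle z, hz⟩ :=
    Subtype.ext hmap
  -- (10.9): `[V]^*c = [V₁]^*(j^*c)`
  rw [← hpush, G.corrAct_eq_corrActGen,
    G.corrActGen_cyclesOfDimMap_whiskerLeft hX hX hX₁ j rfl (show 2 * q + d' = 2 * q + d' from rfl) rfl
      (show 2 * q + 2 * d' = 2 * q + 2 * d' from rfl) ⟨primeCycle z₁, hz₁n⟩,
    LinearMap.comp_apply]
  -- `β = j^*c` is a rational `(q,q)`-class on `X₁` of dimension `d' < 2q`, hence ALGEBRAIC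
  set β : complexBetti X₁ (2 * q) := (complexBetti.map j (2 * q)).hom c with hβ
  have hβrat : IsRationalClass β := hc.map _
  obtain ⟨B₁⟩ := (nonempty_hodgeModel_holds (n := d') (X := X₁)).nonempty hX₁
  have hβtyp : IsOfHodgeType d' X₁ (2 * q) q q β := preservesHodgeType_of_le hX₁ hX B₁ j hd'.le hh
  have hβalg : β ∈ algebraicClasses X₁ q := ih hd' hX₁ q β hβrat hβtyp
  -- `[V₁]^*β = g_*(h^*β)` through a resolution `τ : Ṽ₁ → X ⊗ X₁` of `closure {z₁}`
  obtain ⟨V, τ, η, hV, hηg, hηn, hτ⟩ := exists_resolution_primeCycle hH hXX₁ z₁ hz₁n'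
  haveI : QuasiCompact τ.left := by
    haveI := isProper_left_of_isSmoothProjective hV hXX₁ τ
    infer_instance
  have hη : primeCycle η ∈ cyclesOfDim V.left (2 * q) := primeCycle_mem_cyclesOfDim hηn
  have hτ' : cyclesOfDimMap (2 * q) τ.left ⟨primeCycle η, hη⟩ = ⟨primeCycle z₁, hz₁n⟩ := Subtype.ext hτ
  rw [G.corrActGen_primeCycle_eq hX hX₁ _ _ z₁ hz₁n hV τ η hηg hη hτ' β]
  refine G.gysin_mem_algebraicClasses hV hX (τ ≫ fst X X₁) (p := q) (q := q) rfl ?_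
  -- `h^*β` is a rational `(q,q)`-class on the `2q`-fold `Ṽ₁`, of coniveau `≥ 1` since `h` is dominant
  set h : V ⟶ X₁ := τ ≫ snd X X₁ with hhdef
  have h1rat : IsRationalClass (complexBetti.map h (2 * q) β) := hβrat.map _
  obtain ⟨BV⟩ := (nonempty_hodgeModel_holds (n := 2 * q) (X := V)).nonempty hV
  have h1typ : IsOfHodgeType (2 * q) V (2 * q) q q (complexBetti.map h (2 * q) β) :=
    hβtyp.map_of_independent hI hV hX₁ BV h
  have h1supp : complexBetti.map h (2 * q) β ∈ supportedClasses V (2 * q) 1 := by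
    obtain ⟨S, hS, hSq, hβS⟩ := exists_isClosed_of_mem_supportedClasses hβalg
    have hpre : IsClosed (h.left.base ⁻¹' S) := hS.preimage h.left.base.hom.continuous
    refine mem_supportedClasses_of_restrictCompl_eq_zero hpre
      (fun v hv ↦ one_le_coheight_of_mem_of_isClosed hV hpre ?_ hv)
      (complexBetti.restrictCompl_map_eq_zero h hβS)
    -- `h⁻¹ S ≠ Ṽ₁`: `h η = pr₂ z₁` is the generic point of `X₁`, which is not in `S ⊊ X₁`
    intro huniv
    have hηS : h.left.base η ∈ S := by
      have hmem : η ∈ h.left.base ⁻¹' S := huniv ▸ Set.mem_univ η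
      exact hmem
    have hτη : τ.left.base η = z₁ := base_eq_of_map_primeCycle_eq τ.left η z₁ hτ
    have hhη : h.left.base η = (snd X X₁).left.base z₁ := by
      rw [hhdef, Over.comp_left, Scheme.Hom.comp_apply, hτη]
    have hjsnd : j.left.base ((snd X X₁).left.base z₁) = x' := by
      have e1 : (X ◁ j).left.base z₁ = z := base_eq_of_map_primeCycle_eq (X ◁ j).left z₁ z hmap
      have e2 : ((X ◁ j) ≫ snd X X).left.base z₁ = (snd X X₁ ≫ j).left.base z₁ := by
        rw [whiskerLeft_snd]
      rw [Over.comp_left, Over.comp_left, Scheme.Hom.comp_apply, Scheme.Hom.comp_apply, e1] at e2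
      exact e2.symm
    have hgen : IsGenericPoint ((snd X X₁).left.base z₁) (Set.univ : Set X₁.left) :=
      eq_genericPoint_of_le_height_base hX₁ hX j _ (by rw [hjsnd, hdim])
    have hqS := hSq _ hηS
    rw [hhη] at hqS
    -- the generic point has codimension `0`
    have h0 : Order.coheight ((snd X X₁).left.base z₁) = 0 :=
      Order.coheight_eq_zero.2 fun b _ ↦
        Scheme.le_iff_specializes.2 (hgen.specializes (Set.mem_univ b))
    rw [h0] at hqS
    have : q = 0 := by exact_mod_cast nonpos_iff_eq_zero.1 hqS
    omega
  exact supportedHodgeClasses_algebraic_of_hodgeBelowDim ih hV _ h1rat h1typ h1supp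

/-- **`[Z'']^*c` is algebraic for `Z''` supported in `X × W`, `W ⊊ X` closed, given HC below dimension
`2q`** (`q ≥ 1`): additivity over the prime cycles of `Z''`, each lying over a point of `W`, of
codimension `≥ 1`. [cite: VoisinHodgeII2003, proof of Prop. 10.26 (p. 306)] -/
theorem corrAct_mem_algebraicClasses_of_snd_of_hodgeBelowDim (G : GysinFormalism)
    {q : ℕ} {X : SchemeOver ℂ} (hX : IsSmoothProjective (2 * q) X)
    (hq : 1 ≤ q) (ih : HodgeBelowDim (2 * q)) {Z : ↥(cyclesOfDim (X ⊗ X).left (2 * q))} {W : Set X.left}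
    (hW : IsClosed W) (hWne : W ≠ Set.univ)
    (hZ : ∀ z, (Z : AlgebraicCycle (X ⊗ X).left ℤ) z ≠ 0 → (snd X X).left.base z ∈ W)
    (c : complexBetti X (2 * q)) (hc : IsRationalClass c) (hh : IsOfHodgeType (2 * q) X (2 * q) q q c) :
    G.corrAct hX hX (2 * q) Z c ∈ algebraicClasses X q :=
  G.corrAct_mem_of_primeCycle hX hX (2 * q) _ Z c fun z hz0 hz ↦
    corrAct_primeCycle_mem_algebraicClasses_of_snd_of_hodgeBelowDim G hX hq ih z hz (Z.2 z hz0)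
      (one_le_coheight_of_mem_of_isClosed hX hW hWne (hZ z hz0)) c hc hh

/-! ### The CH₀-degenerate regime of the middle step -/

/-- **Voisin II, Prop. 10.26 in every even dimension `2q ≥ 4`, given HC below — the middle step for
CH₀-degenerate `2q`-folds, granted a Gysin / cycle-class formalism with Hodge-compatible Gysin
morphisms.** For `X` smooth projective of dimension `2q` with `ChowZeroDegenerate X` and a rational
`(q,q)`-class `c`: by the Bloch–Srinivas decomposition of the diagonal (a THEOREM of the tree,
`BlochSrinivas1983_decompositionOfTheDiagonal_holds`) `m[Δ] ∼ Z' + Z''`, `m > 0`, `Z' ⊂ T × X`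
(`T ⊊ X` closed), `Z'' ⊂ X × W`; Lemma 9.18 and `[Δ]^* = Id` give `m c = [Z']^*c + [Z'']^*c`, and both
summands are algebraic (`…_of_fst_of_hodgeBelowDim`, `…_of_snd_of_hodgeBelowDim`); `m ≠ 0` in `ℂ`.
[cite: VoisinHodgeII2003, Prop. 10.26 and its proof (p. 306), Cor. 10.21, Lemma 9.18]
[cite: BlochSrinivas1983] [cite: ConteMurre1978] -/
theorem middleStepChowDegenerate_of_gysin : ∀ (G : GysinFormalism), G.IsGysinHodgeCompatible → MiddleStepFor ChowZeroDegenerate := by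
  intro G hG q X hq hX ih hW c hc hh
  obtain ⟨W, hWne, hW⟩ := (chowZeroDegenerate_iff X).1 hW
  obtain ⟨δ, hδ⟩ := exists_isGenericPoint_range_diagonal hX
  obtain ⟨m, hm, T, hT, hTne, Z', hZ', Z'', hZ'', hZ'T, hZ''W, hrat⟩ :=
    BlochSrinivas1983_decompositionOfTheDiagonal_holds hX hW δ hδ
  -- `Δ` is a `2q`-cycle
  have hn : primeCycle δ ∈ cyclesOfDim (X ⊗ X).left (2 * q) := primeCycle_diagonal_mem_cyclesOfDim hX hδ
  have hrat' : IsRationallyEquivalent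
      ((m • ⟨primeCycle δ, hn⟩ : ↥(cyclesOfDim (X ⊗ X).left (2 * q))) : AlgebraicCycle (X ⊗ X).left ℤ)
      ((⟨Z', hZ'⟩ + ⟨Z'', hZ''⟩ : ↥(cyclesOfDim (X ⊗ X).left (2 * q))) : AlgebraicCycle (X ⊗ X).left ℤ)
      (2 * q) := by
    rw [AddSubgroup.coe_add]
    exact hrat
  -- (10.5): `m • c = [Z']^*c + [Z'']^*c`
  have hact := G.corrAct_congr hX hX (2 * q) hrat'
  rw [map_nsmul, map_add, G.corrAct_primeCycle_diagonal hX (2 * q) δ hδ hn] at hact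
  have hmc : (m : ℂ) • c =
      G.corrAct hX hX (2 * q) ⟨Z', hZ'⟩ c + G.corrAct hX hX (2 * q) ⟨Z'', hZ''⟩ c := by
    have h := LinearMap.congr_fun hact c
    simp only [LinearMap.smul_apply, LinearMap.id_apply, LinearMap.add_apply] at h
    rw [← h, Nat.cast_smul_eq_nsmul ℂ m c]
  have hmem : (m : ℂ) • c ∈ algebraicClasses X q := by
    rw [hmc]
    exact add_mem
      (corrAct_mem_algebraicClasses_of_fst_of_hodgeBelowDim G hG hX ih hT hTne hZ'T c hc hh)
      (corrAct_mem_algebraicClasses_of_snd_of_hodgeBelowDim G hX (by omega) ih hW.1 hWne hZ''W c hc hh)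
  have hm0 : (m : ℂ) ≠ 0 := by exact_mod_cast hm.ne'
  rwa [Submodule.smul_mem_iff _ hm0] at hmem


/-- **Registered stub `stub_chowDegenerateRegime_of_gysin` of the line's skeleton** (crux
stmt-HodgeConjecture-2782, `Cruxes/VerticalSupportMiddle/Lines/regime_split_middle_step.lean`), verbatim:
`middleStepChowDegenerate_of_gysin`. [cite: VoisinHodgeII2003, Prop. 10.26] -/
theorem stub_chowDegenerateRegime_of_gysin : ∀ (G : GysinFormalism), G.IsGysinHodgeCompatible → MiddleStepFor ChowZeroDegenerate :=
  middleStepChowDegenerate_of_gysin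

/-! ### The case `q = 2`: the Hodge conjecture for CH₀-degenerate fourfolds, granted `(G, hG)` -/

/-- **The Hodge conjecture for every smooth projective complex FOURFOLD with degenerate `CH₀`, granted a
Gysin / cycle-class formalism with Hodge-compatible Gysin morphisms** (Conte–Murre 1978 for fourfolds
covered by rational curves; Bloch–Srinivas 1983): at `q = 2` the induction hypothesis `HodgeBelowDim 4`
is the tree's theorem `hodgeBelowDim_four`, so the middle step gives the `(2,2)`-classes and the other
degrees are classical (`hodgeConjectureFor_of_hodgeBelowDim_of_middle`). [cite: ConteMurre1978]
[cite: VoisinHodgeII2003, Prop. 10.26] [cite: BlochSrinivas1983] -/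
theorem hodgeConjectureFor_of_chowZeroDegenerate_fourfold_of_gysin (G : GysinFormalism)
    (hG : G.IsGysinHodgeCompatible) {X : SchemeOver ℂ} (hX : IsSmoothProjective 4 X)
    (hW : ChowZeroDegenerate X) : HodgeConjectureFor 4 X :=
  hodgeConjectureFor_of_hodgeBelowDim_of_middle hodgeBelowDim_four hX fun q hq hq4 c hc hh ↦ by
    obtain rfl : q = 2 := by omega
    exact middleStepChowDegenerate_of_gysin G hG le_rfl hX hodgeBelowDim_four hW c hc hh

/-- **Granted `(G, hG)`, the Hodge conjecture is EQUIVALENT to the heart of the line** — HC for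
CH₀-non-degenerate `2q`-folds in the middle degree, given HC below (`q ≥ 2`): the level-wise reduction
(`hodgeConjecture_of_middleStep`) + the CH₀-degenerate regime proved here. [cite: VoisinHodgeII2003, Prop. 10.26]
[cite: KerrPearlstein2011, §3.1] -/
theorem hodgeConjecture_iff_heart_of_gysin (G : GysinFormalism) (hG : G.IsGysinHodgeCompatible) :
    _root_.HodgeConjecture ↔ MiddleStepFor fun X ↦ ¬ ChowZeroDegenerate X :=
  ⟨fun h ↦ regimes_of_hodgeConjecture h _, fun hH ↦
    hodgeConjecture_of_middleStep (middleStep_of_regimes (middleStepChowDegenerate_of_gysin G hG) hH)⟩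

/-! ### The trust base spelled out: the two named facts behind `(G, hG)` -/

/-- **The CH₀-degenerate regime from Fulton's degree formula and Voisin's Lemma 9.18 for the complex
orientations** (the named facts `Fulton1998_degreeFormula_complexOrientation`,
`Voisin2003_cycleClass_div_eq_zero_complexOrientation`): they yield a Gysin / cycle-class formalism with
Hodge-compatible Gysin morphisms (`exists_gysinFormalism_isGysinHodgeCompatible_complexOrientation`), to
which `middleStepChowDegenerate_of_gysin` applies. CONDITIONAL on exactly these two facts.
[cite: Fulton1998, Lemma 19.1.2] [cite: VoisinHodgeII2003, Lemma 9.18 and Prop. 10.26] -/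
theorem middleStepChowDegenerate_of_complexOrientationFacts
    (hB : Fulton1998_degreeFormula_complexOrientation)
    (hC : Voisin2003_cycleClass_div_eq_zero_complexOrientation) : MiddleStepFor ChowZeroDegenerate := by
  obtain ⟨G, hG, -, -⟩ := exists_gysinFormalism_isGysinHodgeCompatible_complexOrientation hB hC
  exact middleStepChowDegenerate_of_gysin G hG

/-- **The CH₀-degenerate regime from Fulton's degree formula and the spanning of the rational
`(d,d)`-classes of `(d+1)`-folds by pull-backs from `ℙ^{d+1}`** (the named facts
`Fulton1998_degreeFormula_complexOrientation`, `topHodgeClasses_spanned_by_pullbacks`; Lemma 9.18 for the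
complex orientations follows from them,
`Voisin2003_cycleClass_div_eq_zero_complexOrientation_of_degreeFormula_of_spanning`). CONDITIONAL on
exactly these two facts. [cite: Fulton1998, Lemma 19.1.2] [cite: VoisinHodgeI2002, Thm. 6.25 and Thm. 11.30]
[cite: VoisinHodgeII2003, Prop. 10.26] -/
theorem middleStepChowDegenerate_of_degreeFormula_of_spanning
    (hB : Fulton1998_degreeFormula_complexOrientation) (hS : topHodgeClasses_spanned_by_pullbacks) :
    MiddleStepFor ChowZeroDegenerate :=
  middleStepChowDegenerate_of_complexOrientationFacts hB
    (Voisin2003_cycleClass_div_eq_zero_complexOrientation_of_degreeFormula_of_spanning hB hS)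

end Summit.HodgeConjecture.HodgeConjecture.Theorems

end
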